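import Mathlib
import HarnessLib
import Literature.RingTheory.CohomologyAnnihilator.Basic
import Literature.AlgebraicGeometry.Morphisms.CechModule
import Literature.AlgebraicGeometry.Modules.AffineLocalizing
import Literature.AlgebraicGeometry.Resolution.ReflexiveModulesRationalDoublePoints
import Summits.ResolutionOfSingularities.ResolutionOfSingularities.Theorems.HomologicalConductorNoZenoStableEnd

/-!
# Crux `NoZenoR` / `NoZeno` (stmt-ResolutionOfSingularities-19943 / -16483), line `sandwich-cluster`,
# G-layer: THE ASSEMBLY OF Ga («`ca(T)` is an `X_min`-carried ideal») from its typed pieces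
# (lead res-L0-w44-lead-1, KERNEL-L0 §16 R6; skeleton v19 `Sig.stubG_caCarried`)

Route `ResolutionOfSingularities/HomologicalConductor`.  OURS (cell res-hironaka, crux chain W4.4); nothing
here is a statement of the manuscript under review (Hironaka 2017); AI-written, weaker than expert review.
ROUTE-INDEPENDENT (no `Theses` import).

THEOREM A's deep half Ga says: on a resolution `π : X ⟶ Spec T` of the two-dimensional normal local `T`,
the cohomology annihilator is cut out by orders along the exceptional curves,
`ca(T) = {t | t = 0 ∨ ∀ η, Z η ≤ ord_η t}` for one cycle `Z`.  The chain proves it in pieces owned by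
different seats; this file is the kernel-checked GLUE, with every piece an explicit hypothesis in exactly
the shape its owner typed:

* `hca` — the CA-layer (CA1–CA5; res-L0-w44-stub-5, res-L0-w44-stub-7, res-D-pv-043): `ca(T) = ⋂_j ann_T End̲_T(N_j)`
  over a family of finitely generated modules `N_j` (the duals `L^*` of the high syzygies);
* `hG2` — the full-sheaf package (res-D-pv-045 AS stub-8, `exists_locallyFree_stableEnd_equiv_cechMH1`,
  weakened to what is consumed): each `End̲_T(N_j)` is `T`-isomorphic to `Ȟ¹(𝒰, F_j)` for an
  affine-localizing `𝒪_X`-module `F_j`, for the fixed finite affine cover `𝒰`;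
* `hL` — LEMMA L (res-L0-w44-stub-2, `mem_annihilator_cechMH1_of_forall_excOrd_le`, after its geometric
  side conditions are supplied): the annihilator of `Ȟ¹(𝒰, F)` of an affine-localizing `F`, when it
  contains a power of `𝔪`, is EXCEPTIONAL-VALUATIVE;
* `hord` — orders of non-zero elements of `T` along exceptional curves are `≥ 0` (dictionary);
* `y` — one non-zero element of `ca(T)` (`ca ⊇ 𝔪^c ≠ 0`), bounding all cycles.

Output: `caCarried_of_pieces` — one cycle `Z : X → ℕ` with `t ∈ ca(T) ↔ (t = 0 ∨ ∀ η ∈ excPoints π,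
Z η ≤ ord_η t)` (Q-rat (E4)–(E5): per-module cycles `Z_j = min ord(𝔞_j ∖ 0)` by Lemma L, then the bounded
supremum over `j`).  Indexing by `excPoints` (stub-2's); the skeleton converts to `excCurvePoints` (stub-4's)
by the dictionary `excCurvePoints π = excPoints π` on `X_min`.

References: J. Lipman, Publ. IHÉS 36 (1969), §18 (complete ideals and exceptional cycles) [`Lipman1969`];
S. Iyengar, R. Takahashi, IMRN 2016, Def. 2.1 [`IyengarTakahashi2014`].
-/

noncomputable section

-- single-problem summit: the doubled namespace component `ResolutionOfSingularities` is forced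
set_option linter.dupNamespace false

namespace Summit.ResolutionOfSingularities.ResolutionOfSingularities.Theorems.NoZeno.SandwichCluster

open CategoryTheory AlgebraicGeometry TopologicalSpace IsLocalRing
open Literature.RingTheory.CohomologyAnnihilator (cohomologyAnnihilator)
open Literature.AlgebraicGeometry.Morphisms Literature.AlgebraicGeometry.Modules
open Literature.AlgebraicGeometry.Resolution

section Assembly

variable {T : Type} [CommRing T] [IsLocalRing T]
  {X : Scheme.{0}} [IsIntegral X] [IsLocallyNoetherian X] (π : X ⟶ Spec (.of T))

/-- **One annihilator is carried** (Q-rat (E4) for a single module): if `𝔞 ⊆ T` is exceptional-valuative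
in the sense of LEMMA L (membership follows from dominating, at each exceptional curve, the order of some
non-zero element of `𝔞`) and contains a non-zero element, then `𝔞 = I_Z` for the cycle
`Z η = min {ord_η a : a ∈ 𝔞 ∖ 0}`, and `Z ≤ ord y` for every non-zero `y ∈ 𝔞`. [folklore] -/
theorem exists_cycle_of_valuative (𝔞 : Ideal T)
    (hord : ∀ t : T, t ≠ 0 → ∀ η ∈ excPoints π, 0 ≤ Scheme.ord (baseToFunctionField π t) η)
    (hval : ∀ t : T, (∀ η ∈ excPoints π, ∃ a ∈ 𝔞, a ≠ 0 ∧
        Scheme.ord (baseToFunctionField π a) η ≤ Scheme.ord (baseToFunctionField π t) η) → t ∈ 𝔞)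
    (y : T) (hy0 : y ≠ 0) (hy : y ∈ 𝔞) :
    ∃ Z : X → ℕ, (∀ η ∈ excPoints π, (Z η : ℤ) ≤ Scheme.ord (baseToFunctionField π y) η) ∧
      ∀ t : T, t ∈ 𝔞 ↔ (t = 0 ∨ ∀ η ∈ excPoints π, (Z η : ℤ) ≤ Scheme.ord (baseToFunctionField π t) η) := by
  classical
  -- at each `η`, the set of natural numbers `(ord_η a).toNat`, `a ∈ 𝔞 ∖ 0`, is non-empty (it contains `y`'s)
  have hex : ∀ η : X, ∃ n : ℕ, ∃ a ∈ 𝔞, a ≠ 0 ∧ (Scheme.ord (baseToFunctionField π a) η).toNat = n :=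
    fun η => ⟨_, y, hy, hy0, rfl⟩
  let Z : X → ℕ := fun η => Nat.find (hex η)
  have hZspec : ∀ η, ∃ a ∈ 𝔞, a ≠ 0 ∧ (Scheme.ord (baseToFunctionField π a) η).toNat = Z η :=
    fun η => Nat.find_spec (hex η)
  have hZmin : ∀ η, ∀ a ∈ 𝔞, a ≠ 0 → Z η ≤ (Scheme.ord (baseToFunctionField π a) η).toNat :=
    fun η a ha ha0 => Nat.find_min' (hex η) ⟨a, ha, ha0, rfl⟩
  -- for non-zero `a` and exceptional `η` the order is `≥ 0`, so `toNat` is faithful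
  have hcoe : ∀ a : T, a ≠ 0 → ∀ η ∈ excPoints π,
      (((Scheme.ord (baseToFunctionField π a) η).toNat : ℕ) : ℤ) = Scheme.ord (baseToFunctionField π a) η :=
    fun a ha0 η hη => Int.toNat_of_nonneg (hord a ha0 η hη)
  refine ⟨Z, fun η hη => ?_, fun t => ⟨fun ht => ?_, fun ht => ?_⟩⟩
  · rw [← hcoe y hy0 η hη]
    exact_mod_cast hZmin η y hy hy0
  · by_cases ht0 : t = 0
    · exact Or.inl ht0
    · refine Or.inr fun η hη => ?_
      rw [← hcoe t ht0 η hη]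
      exact_mod_cast hZmin η t ht ht0
  · rcases ht with rfl | ht
    · exact 𝔞.zero_mem
    · refine hval t fun η hη => ?_
      obtain ⟨a, ha, ha0, haZ⟩ := hZspec η
      refine ⟨a, ha, ha0, ?_⟩
      rw [← hcoe a ha0 η hη, haZ]
      exact ht η hη

/-- **Ga ASSEMBLED: `ca(T)` is an `X`-carried ideal** (Q-rat (E4)–(E5)).  Pieces, all hypotheses in their
owners' shapes: `hca` (CA-layer: `ca = ⋂_j ann End̲(N_j)`), `hG2` (full-sheaf package: `End̲(N_j) ≃ Ȟ¹(𝒰, F_j)`,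
`F_j` affine-localizing, on the fixed finite affine cover `𝒰`), `hL` (LEMMA L for affine-localizing sheaves
whose `Ȟ¹`-annihilator contains a power of `𝔪`), `hc` (`𝔪^c ⊆ ca`), `hord` (orders of regular functions
are `≥ 0`), `y ∈ ca ∖ 0`.  Conclusion: ONE cycle `Z` with `ca(T) = {t | t = 0 ∨ ∀ η ∈ excPoints π, Z η ≤ ord_η t}`.
[this work] -/
theorem caCarried_of_pieces
    {ι : Type} (U : ι → X.Opens)
    (hord : ∀ t : T, t ≠ 0 → ∀ η ∈ excPoints π, 0 ≤ Scheme.ord (baseToFunctionField π t) η)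
    -- CA-layer: `ca(T)` is the intersection of the annihilators of the stable endomorphism modules
    {ιN : Type} (N : ιN → Type) [∀ j, AddCommGroup (N j)] [∀ j, Module T (N j)]
    (hca : ∀ t : T, t ∈ cohomologyAnnihilator T ↔ ∀ j, t ∈ Module.annihilator T (StableEnd T (N j)))
    -- full-sheaf package, consumed form: `End̲(N_j) ≃ Ȟ¹(𝒰, F_j)` with `F_j` affine-localizing
    (hG2 : ∀ j, ∃ F : X.Modules, IsAffineLocalizing F ∧ Nonempty (StableEnd T (N j) ≃ₗ[T] CechMH1 π F U))
    -- LEMMA L, consumed form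
    (hL : ∀ F : X.Modules, IsAffineLocalizing F → ∀ c : ℕ,
      maximalIdeal T ^ c ≤ Module.annihilator T (CechMH1 π F U) →
      ∀ t : T, (∀ η ∈ excPoints π, ∃ a ∈ Module.annihilator T (CechMH1 π F U), a ≠ 0 ∧
        Scheme.ord (baseToFunctionField π a) η ≤ Scheme.ord (baseToFunctionField π t) η) →
        t ∈ Module.annihilator T (CechMH1 π F U))
    -- `ca ⊇ 𝔪^c`, and one non-zero element of `ca`
    (c : ℕ) (hc : maximalIdeal T ^ c ≤ cohomologyAnnihilator T)
    (y : T) (hy0 : y ≠ 0) (hy : y ∈ cohomologyAnnihilator T) :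
    ∃ Z : X → ℕ, ∀ t : T, t ∈ cohomologyAnnihilator T ↔
      (t = 0 ∨ ∀ η ∈ excPoints π, (Z η : ℤ) ≤ Scheme.ord (baseToFunctionField π t) η) := by
  classical
  -- the sheaves and the comparison isomorphisms
  choose F hFaff hFe using hG2
  have e : ∀ j, StableEnd T (N j) ≃ₗ[T] CechMH1 π (F j) U := fun j => Classical.choice (hFe j)
  -- the annihilators `𝔞_j`
  set 𝔞 : ιN → Ideal T := fun j => Module.annihilator T (CechMH1 π (F j) U) with h𝔞
  have h𝔞eq : ∀ j, Module.annihilator T (StableEnd T (N j)) = 𝔞 j := fun j => (e j).annihilator_eq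
  have hca' : ∀ t : T, t ∈ cohomologyAnnihilator T ↔ ∀ j, t ∈ 𝔞 j := fun t => by
    rw [hca t]; exact forall_congr' fun j => by rw [h𝔞eq j]
  have hca_le : ∀ j, cohomologyAnnihilator T ≤ 𝔞 j := fun j t ht => (hca' t).mp ht j
  -- each `𝔞_j` is carried by a cycle `Z_j ≤ ord y` (Lemma L + `exists_cycle_of_valuative`)
  have hZj : ∀ j, ∃ Zj : X → ℕ, (∀ η ∈ excPoints π, (Zj η : ℤ) ≤ Scheme.ord (baseToFunctionField π y) η) ∧
      ∀ t : T, t ∈ 𝔞 j ↔ (t = 0 ∨ ∀ η ∈ excPoints π, (Zj η : ℤ) ≤ Scheme.ord (baseToFunctionField π t) η) :=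
    fun j => exists_cycle_of_valuative π (𝔞 j) hord
      (hL (F j) (hFaff j) c (hc.trans (hca_le j))) y hy0 (hca_le j hy)
  choose Zf hZfy hZf using hZj
  -- the bounded supremum `Z η = sup_j Z_j η ≤ (ord_η y).toNat`
  have hbdd : ∀ η ∈ excPoints π, BddAbove (Set.range fun j => Zf j η) := fun η hη =>
    ⟨(Scheme.ord (baseToFunctionField π y) η).toNat, by
      rintro _ ⟨j, rfl⟩
      exact (Int.le_toNat (hord y hy0 η hη)).mpr (hZfy j η hη)⟩
  set Z : X → ℕ := fun η => if η ∈ excPoints π then ⨆ j, Zf j η else 0 with hZdef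
  have hZη : ∀ η ∈ excPoints π, Z η = ⨆ j, Zf j η := fun η hη => by simp [hZdef, hη]
  refine ⟨Z, fun t => ?_⟩
  rw [hca' t]
  constructor
  · intro ht
    by_cases ht0 : t = 0
    · exact Or.inl ht0
    · refine Or.inr fun η hη => ?_
      rw [hZη η hη]
      have h0 : 0 ≤ Scheme.ord (baseToFunctionField π t) η := hord t ht0 η hη
      -- every `Z_j η ≤ ord_η t`
      have hall : ∀ j, Zf j η ≤ (Scheme.ord (baseToFunctionField π t) η).toNat := fun j => by
        rcases (hZf j t).mp (ht j) with h | h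
        · exact absurd h ht0
        · exact (Int.le_toNat h0).mpr (h η hη)
      rcases isEmpty_or_nonempty ιN with hι | hι
      · simp only [ciSup_of_empty, bot_eq_zero', Nat.cast_zero]
        exact h0
      · exact (Int.le_toNat h0).mp (ciSup_le hall)
  · rintro (rfl | ht) j
    · exact (𝔞 j).zero_mem
    · refine (hZf j t).mpr (Or.inr fun η hη => ?_)
      have h := ht η hη
      rw [hZη η hη] at h
      have hle : Zf j η ≤ ⨆ j, Zf j η := le_ciSup (hbdd η hη) j
      calc (Zf j η : ℤ) ≤ ((⨆ j, Zf j η : ℕ) : ℤ) := by exact_mod_cast hle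
        _ ≤ _ := h

end Assembly

end Summit.ResolutionOfSingularities.ResolutionOfSingularities.Theorems.NoZeno.SandwichCluster

end
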